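import Summits.ResolutionOfSingularities.ResolutionOfSingularities.Theorems.FrobeniusLadderFRationalResolutionQuadricConeResolution
import Summits.ResolutionOfSingularities.ResolutionOfSingularities.Theorems.FrobeniusLadderFRationalResolutionChartGraphProd
import HarnessLib

/-!
# Rung 4′ at a singular threefold of the residual class: the cone over `ℙ¹ × ℙ¹`, resolved

Support file for crux stmt-ResolutionOfSingularities-15317 (`FrobeniusLadder.FRationalResolution`),
line `Sketch`, continuation seat c2, wave 2. The suspension `Σ(x₁x₂) = Spec k[y,z,x₁,x₂]/(yz + x₁x₂)`
(a threefold, singular at the vertex, in the residual class by the calibration) is resolved for every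
field `k` by ONE blowing up of the vertex: all four charts are graph charts `≅ k[3 variables]`
(`stub_chart_graph_prod`, applied four times through the symmetry of `yz + x₁x₂`).

* `adjoin_mk_X_eq_top₂`, `hasResolution_coneProd`, `coneProd_singular_hasResolution` (dimension 3
  was so far only conditional on `CossartPiltant2019`, p131133).
-/

-- single-problem summit: the doubled namespace component `ResolutionOfSingularities` is forced
set_option linter.dupNamespace false

noncomputable section

open CategoryTheory AlgebraicGeometry TopologicalSpace
open Literature.AlgebraicGeometry.Resolution Literature.RingTheory.TightClosure

namespace Summit.ResolutionOfSingularities.ResolutionOfSingularities.Theorems.FRationalResolution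

section ConeProd

open MvPolynomial

variable (k : Type) [Field k]

/-- The four generators of `k[y,z,x₁,x₂]/(g)` generate it as a `k`-algebra. -/
theorem adjoin_mk_X_eq_top₂ (g : MvPolynomial (Fin 2 ⊕ Fin 2) k) :
    Algebra.adjoin k {Ideal.Quotient.mk (Ideal.span {g}) (X (Sum.inr 0)),
      Ideal.Quotient.mk (Ideal.span {g}) (X (Sum.inr 1)),
      Ideal.Quotient.mk (Ideal.span {g}) (X (Sum.inl 0)),
      Ideal.Quotient.mk (Ideal.span {g}) (X (Sum.inl 1))} = ⊤ := by
  have hrange : (Set.range (X : Fin 2 ⊕ Fin 2 → MvPolynomial (Fin 2 ⊕ Fin 2) k)) =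
      {X (Sum.inr 0), X (Sum.inr 1), X (Sum.inl 0), X (Sum.inl 1)} := by
    ext q
    simp only [Set.mem_range, Set.mem_insert_iff, Set.mem_singleton_iff]
    constructor
    · rintro ⟨i, rfl⟩
      rcases i with i | i
      · fin_cases i <;> simp
      · fin_cases i <;> simp
    · rintro (rfl | rfl | rfl | rfl)
      · exact ⟨Sum.inr 0, rfl⟩
      · exact ⟨Sum.inr 1, rfl⟩
      · exact ⟨Sum.inl 0, rfl⟩
      · exact ⟨Sum.inl 1, rfl⟩
  have h1 : Algebra.adjoin k (Set.range (X : Fin 2 ⊕ Fin 2 → MvPolynomial (Fin 2 ⊕ Fin 2) k)) = ⊤ :=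
    MvPolynomial.adjoin_range_X
  have h2 := congrArg (Subalgebra.map (Ideal.Quotient.mkₐ k (Ideal.span {g}))) h1
  rw [AlgHom.map_adjoin, Algebra.map_top, (AlgHom.range_eq_top _).mpr
    (Ideal.Quotient.mkₐ_surjective k (Ideal.span {g})), hrange] at h2
  simpa [Set.image_insert_eq, Set.image_singleton, Ideal.Quotient.mkₐ_eq_mk] using h2

set_option maxHeartbeats 400000 in
/-- **The cone over `ℙ¹ × ℙ¹` has a resolution of singularities, for every field `k`**:
`X = Spec k[y,z,x₁,x₂]/(yz + x₁x₂)` (the suspension `Σ(x₁x₂)`, a threefold whose vertex is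
singular — `suspension_not_isRegular` with `f = x₁x₂ ∈ (x)²`) is resolved by the blowing up of the
vertex `I = (y, z, x₁, x₂)`: the four charts are the graph charts `R[I/y] ≅ k[Y, X₁', X₂']` etc.
(`stub_chart_graph_prod`, used four times through the symmetry of `yz + x₁x₂`), so `Bl_I X` is
regular and `affineBlowup.isResolution` applies. Rung 4′ at a singular THREEFOLD of the residual
class, unconditionally (dimension 3 was so far conditional on `CossartPiltant2019`, p131133). -/
theorem hasResolution_coneProd :
    Scheme.HasResolution (Spec (CommRingCat.of (MvPolynomial (Fin 2 ⊕ Fin 2) k ⧸ Ideal.span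
      {(MvPolynomial.X (Sum.inl 0) * MvPolynomial.X (Sum.inl 1) +
        MvPolynomial.rename Sum.inr (MvPolynomial.X 0 * MvPolynomial.X 1) :
          MvPolynomial (Fin 2 ⊕ Fin 2) k)}))) := by
  set g : MvPolynomial (Fin 2 ⊕ Fin 2) k :=
    X (Sum.inl 0) * X (Sum.inl 1) + rename Sum.inr (X 0 * X 1) with hg
  haveI hprime : (Ideal.span {g}).IsPrime :=
    isPrime_span_suspension k 2 (X 0 * X 1) (mul_ne_zero (X_ne_zero 0) (X_ne_zero 1))
  haveI : IsDomain (MvPolynomial (Fin 2 ⊕ Fin 2) k ⧸ Ideal.span {g}) := Ideal.Quotient.isDomain _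
  set mk : MvPolynomial (Fin 2 ⊕ Fin 2) k →ₐ[k] MvPolynomial (Fin 2 ⊕ Fin 2) k ⧸ Ideal.span {g} :=
    Ideal.Quotient.mkₐ k (Ideal.span {g}) with hmk
  set x₁ := mk (X (Sum.inr 0)) with hx₁
  set x₂ := mk (X (Sum.inr 1)) with hx₂
  set yb := mk (X (Sum.inl 0)) with hyb
  set zb := mk (X (Sum.inl 1)) with hzb
  have hrel : yb * zb + x₁ * x₂ = 0 := by
    have : mk g = 0 := by
      rw [hmk, Ideal.Quotient.mkₐ_eq_mk, Ideal.Quotient.eq_zero_iff_mem]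
      exact Ideal.mem_span_singleton_self g
    simpa [hg, map_add, map_mul, rename_X] using this
  have hgen : Algebra.adjoin k {x₁, x₂, yb, zb} = ⊤ := adjoin_mk_X_eq_top₂ k g
  -- the generic test map: `p ↦ Y`, `q ↦ X₁'Y`, `r ↦ X₂'Y`, `s ↦ −X₁'X₂'Y` on a permutation of the variables
  set u₀ := algebraMap (MvPolynomial (Fin 3) k)
    (Localization.Away (MvPolynomial.X 0 : MvPolynomial (Fin 3) k)) (X 0) with hu₀
  set u₁ := algebraMap (MvPolynomial (Fin 3) k)
    (Localization.Away (MvPolynomial.X 0 : MvPolynomial (Fin 3) k)) (X 1) with hu₁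
  set u₂ := algebraMap (MvPolynomial (Fin 3) k)
    (Localization.Away (MvPolynomial.X 0 : MvPolynomial (Fin 3) k)) (X 2) with hu₂
  have hlift : ∀ (θ₀ : MvPolynomial (Fin 2 ⊕ Fin 2) k →ₐ[k]
      Localization.Away (MvPolynomial.X 0 : MvPolynomial (Fin 3) k)), θ₀ g = 0 →
      ∀ s ∈ Ideal.span {g}, θ₀ s = 0 := by
    intro θ₀ h0 s hs
    obtain ⟨r, rfl⟩ := Ideal.mem_span_singleton'.mp hs
    rw [map_mul, h0, mul_zero]
  -- images of (y, z, x₁, x₂) for the four charts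
  have key : ∀ (F : Fin 2 ⊕ Fin 2 → Localization.Away (MvPolynomial.X 0 : MvPolynomial (Fin 3) k)),
      F (Sum.inl 0) * F (Sum.inl 1) + F (Sum.inr 0) * F (Sum.inr 1) = 0 →
      ∃ θ : (MvPolynomial (Fin 2 ⊕ Fin 2) k ⧸ Ideal.span {g}) →ₐ[k]
        Localization.Away (MvPolynomial.X 0 : MvPolynomial (Fin 3) k),
        θ yb = F (Sum.inl 0) ∧ θ zb = F (Sum.inl 1) ∧ θ x₁ = F (Sum.inr 0) ∧ θ x₂ = F (Sum.inr 1) := by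
    intro F hF
    have h0 : aeval F g = 0 := by
      rw [hg, map_add, map_mul, aeval_X, aeval_X, aeval_rename, map_mul, aeval_X, aeval_X]
      exact hF
    refine ⟨Ideal.Quotient.liftₐ (Ideal.span {g}) (aeval F) (hlift _ h0), ?_, ?_, ?_, ?_⟩
    all_goals
      exact (AlgHom.congr_fun (Ideal.Quotient.liftₐ_comp (Ideal.span {g}) (aeval F) (hlift _ h0))
        (X _)).trans (aeval_X F _)
  -- chart y
  have hBy : IsRegularRing (blowupAlgebra (Ideal.span {x₁, x₂, yb, zb}) yb) := by
    obtain ⟨θ, h1, h2, h3, h4⟩ := key (Sum.elim ![u₀, -(u₁ * u₂ * u₀)] ![u₁ * u₀, u₂ * u₀])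
      (by simp; ring)
    refine stub_chart_graph_prod k _ x₁ x₂ yb zb hrel hgen θ ?_ ?_ ?_ ?_
    · rw [h1]; rfl
    · rw [h3, map_mul]; rfl
    · rw [h4, map_mul]; rfl
    · rw [h2, map_mul, map_mul]; rfl
  -- chart z
  have hBz : IsRegularRing (blowupAlgebra (Ideal.span {x₁, x₂, yb, zb}) zb) := by
    obtain ⟨θ, h1, h2, h3, h4⟩ := key (Sum.elim ![-(u₁ * u₂ * u₀), u₀] ![u₁ * u₀, u₂ * u₀])
      (by simp; ring)
    have h := stub_chart_graph_prod k _ x₁ x₂ zb yb (by rw [mul_comm]; exact hrel)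
      (by rw [← hgen]; congr 1; ext q; simp only [Set.mem_insert_iff, Set.mem_singleton_iff]; tauto)
      θ ?_ ?_ ?_ ?_
    · have hset : ({x₁, x₂, zb, yb} : Set (MvPolynomial (Fin 2 ⊕ Fin 2) k ⧸ Ideal.span {g})) =
          {x₁, x₂, yb, zb} := by
        ext q; simp only [Set.mem_insert_iff, Set.mem_singleton_iff]; tauto
      rwa [hset] at h
    · rw [h2]; rfl
    · rw [h3, map_mul]; rfl
    · rw [h4, map_mul]; rfl
    · rw [h1, map_mul, map_mul]; rfl
  -- chart x₁
  have hBx₁ : IsRegularRing (blowupAlgebra (Ideal.span {x₁, x₂, yb, zb}) x₁) := by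
    obtain ⟨θ, h1, h2, h3, h4⟩ := key (Sum.elim ![u₁ * u₀, u₂ * u₀] ![u₀, -(u₁ * u₂ * u₀)])
      (by simp; ring)
    have h := stub_chart_graph_prod k _ yb zb x₁ x₂ (by rw [add_comm]; exact hrel)
      (by rw [← hgen]; congr 1; ext q; simp only [Set.mem_insert_iff, Set.mem_singleton_iff]; tauto)
      θ ?_ ?_ ?_ ?_
    · have hset : ({yb, zb, x₁, x₂} : Set (MvPolynomial (Fin 2 ⊕ Fin 2) k ⧸ Ideal.span {g})) =
          {x₁, x₂, yb, zb} := by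
        ext q; simp only [Set.mem_insert_iff, Set.mem_singleton_iff]; tauto
      rwa [hset] at h
    · rw [h3]; rfl
    · rw [h1, map_mul]; rfl
    · rw [h2, map_mul]; rfl
    · rw [h4, map_mul, map_mul]; rfl
  -- chart x₂
  have hBx₂ : IsRegularRing (blowupAlgebra (Ideal.span {x₁, x₂, yb, zb}) x₂) := by
    obtain ⟨θ, h1, h2, h3, h4⟩ := key (Sum.elim ![u₁ * u₀, u₂ * u₀] ![-(u₁ * u₂ * u₀), u₀])
      (by simp; ring)
    have h := stub_chart_graph_prod k _ yb zb x₂ x₁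
      (by rw [add_comm, mul_comm x₂]; exact hrel)
      (by rw [← hgen]; congr 1; ext q; simp only [Set.mem_insert_iff, Set.mem_singleton_iff]; tauto)
      θ ?_ ?_ ?_ ?_
    · have hset : ({yb, zb, x₂, x₁} : Set (MvPolynomial (Fin 2 ⊕ Fin 2) k ⧸ Ideal.span {g})) =
          {x₁, x₂, yb, zb} := by
        ext q; simp only [Set.mem_insert_iff, Set.mem_singleton_iff]; tauto
      rwa [hset] at h
    · rw [h4]; rfl
    · rw [h1, map_mul]; rfl
    · rw [h2, map_mul]; rfl
    · rw [h3, map_mul, map_mul]; rfl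
  -- the centre as a family and the chart cover
  set v : Fin 4 → MvPolynomial (Fin 2 ⊕ Fin 2) k ⧸ Ideal.span {g} := ![yb, zb, x₁, x₂] with hv
  have hIv : Ideal.span (Set.range v) = Ideal.span {x₁, x₂, yb, zb} := by
    congr 1
    ext q
    simp only [hv, Matrix.range_cons, Matrix.range_empty, Set.union_empty, Set.union_singleton,
      Set.mem_insert_iff, Set.mem_singleton_iff, Set.mem_union]
    tauto
  have hreg : Scheme.IsRegular (affineBlowup (Ideal.span (Set.range v))) := by
    refine Scheme.IsRegular.of_forall_exists_isOpenImmersion fun p => ?_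
    have hp : p ∈ (⨆ i : Fin 4, Proj.basicOpen (reesGrading (Ideal.span (Set.range v)))
        (reesT (v i) (Ideal.mem_span_range_self (f := v) (x := i)))) := by
      rw [affineBlowup.iSup_basicOpen_reesT_generators_eq_top v]; trivial
    obtain ⟨i, hi⟩ := Opens.mem_iSup.mp hp
    have hB : IsRegularRing (blowupAlgebra (Ideal.span (Set.range v)) (v i)) := by
      rw [hIv]
      fin_cases i
      · exact hBy
      · exact hBz
      · exact hBx₁
      · exact hBx₂
    haveI := hB
    haveI : IsRegularRing (CommRingCat.of (HomogeneousLocalization.Away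
        (reesGrading (Ideal.span (Set.range v)))
        (reesT (v i) (Ideal.mem_span_range_self (f := v) (x := i))))) :=
      IsRegularRing.of_ringEquiv (reesChartEquiv (v i) _).symm
    refine ⟨_, Proj.awayι (reesGrading (Ideal.span (Set.range v))) (reesT (v i) _) (reesT_mem (v i) _)
      Nat.one_pos, inferInstance, ?_, Scheme.isRegular_Spec _⟩
    rw [← Scheme.Hom.coe_opensRange, Proj.opensRange_awayι]
    exact hi
  have hI0 : Ideal.span (Set.range v) ≠ ⊥ := by
    intro h0
    have hyI : yb ∈ Ideal.span (Set.range v) := Ideal.subset_span ⟨0, rfl⟩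
    have hy0 : yb = 0 := by simpa [h0] using hyI
    obtain ⟨θ, h1, -, -, -⟩ := key (Sum.elim ![u₀, -(u₁ * u₂ * u₀)] ![u₁ * u₀, u₂ * u₀])
      (by simp; ring)
    have h1' : θ yb = u₀ := by rw [h1]; rfl
    rw [hy0, map_zero] at h1'
    have hinj : Function.Injective (algebraMap (MvPolynomial (Fin 3) k)
        (Localization.Away (MvPolynomial.X 0 : MvPolynomial (Fin 3) k))) :=
      IsLocalization.injective _ (powers_le_nonZeroDivisors_of_noZeroDivisors (X_ne_zero 0))
    exact X_ne_zero (R := k) (0 : Fin 3) (hinj (by rw [map_zero]; exact h1'.symm))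
  exact ⟨_, affineBlowup.π _, affineBlowup.isResolution hI0 hreg⟩

end ConeProd

/-- **A singular threefold of the residual class, resolved**: `Σ(x₁x₂)` is not regular
(`suspension_not_isRegular`, `x₁x₂ ∈ (x)²`) and has a resolution (`hasResolution_coneProd`). -/
theorem coneProd_singular_hasResolution (k : Type) [Field k] (p : ℕ) [Fact p.Prime] [CharP k p] :
    ¬ Scheme.IsRegular (Spec (CommRingCat.of (MvPolynomial (Fin 2 ⊕ Fin 2) k ⧸ Ideal.span
      {(MvPolynomial.X (Sum.inl 0) * MvPolynomial.X (Sum.inl 1) +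
        MvPolynomial.rename Sum.inr (MvPolynomial.X 0 * MvPolynomial.X 1) :
          MvPolynomial (Fin 2 ⊕ Fin 2) k)}))) ∧
    Scheme.HasResolution (Spec (CommRingCat.of (MvPolynomial (Fin 2 ⊕ Fin 2) k ⧸ Ideal.span
      {(MvPolynomial.X (Sum.inl 0) * MvPolynomial.X (Sum.inl 1) +
        MvPolynomial.rename Sum.inr (MvPolynomial.X 0 * MvPolynomial.X 1) :
          MvPolynomial (Fin 2 ⊕ Fin 2) k)}))) :=
  ⟨suspension_not_isRegular k 2 (MvPolynomial.X 0 * MvPolynomial.X 1) p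
    (mul_ne_zero (MvPolynomial.X_ne_zero 0) (MvPolynomial.X_ne_zero 1))
    (by
      simpa only [pow_two] using
        Ideal.mul_mem_mul (Ideal.subset_span (Set.mem_range_self 0))
          (Ideal.subset_span (Set.mem_range_self 1))),
    hasResolution_coneProd k⟩

end Summit.ResolutionOfSingularities.ResolutionOfSingularities.Theorems.FRationalResolution

end
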